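import Mathlib
import Summits.Ventures.PercRepro2.Defs
import Summits.Ventures.PercRepro2.Graph
import Summits.Ventures.PercRepro2.MM0Sector
import Summits.Ventures.PercRepro2.MM0Pinned
import Summits.Ventures.PercRepro2.MM0LocalInjection
import Summits.Ventures.PercRepro2.MM0SExchange
import Summits.Ventures.PercRepro2.MM0SExchangeKernel

/-!
# The content of `PinnedMM0` sits in the overlapping triples
(blind cell PercRepro2, night-1 g3; `proofs/NIGHT1-INJ.md` §2)

A triple `(x, y, z)` is NON-OVERLAPPING (`NonOverlap`) when the s-clusters `C_x(s)`, `C_y(s)` both avoid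
`K⁺_x` (the cluster of `t` in `x + uw`) and `x`, `y` agree on every edge touching both `K⁺_x` and
`C_x(s) ∪ C_y(s)`.  For such a triple the s-exchange `σ` (which replaces the s-cluster of `x` by that
of `y`) leaves the whole t-side of `x` untouched: `K⁺_{x'} = K⁺_x` (`kplus_sExchange`), `x' ∈ Zev ↔ x ∈ Zev`
(`zev_sExchange_iff`), and `x' ∈ gate ↔ y ∈ R` (`gate_sExchange_iff_of_nonOverlap`, no bridge can
appear).  Hence `K(χ) + K(σχ) = 0` (`tripleKernel_add_sExchange_eq_zero`); non-overlap is preserved by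
`σ` (`nonOverlap_sExchange`), so the kernel sums to `0` over the non-overlapping part of every fibre
(`sum_nonOverlap_eq_zero`) and

  **`c(pat) = ∑_{(x,y,z) ∈ fibre(pat), ¬NonOverlap} K(x,y,z)`**   (`patternCoeff3_eq_sum_overlap`).

So `PinnedMM0` — hence (MM0⁻) for every weight vector — is EXACTLY the statement that the signed count
of the OVERLAPPING triples (y's s-cluster runs through x's t-side, or a y-open edge joins
`C_x(s) ∖ C_y(s)` to `K⁺_x`) is nonpositive on every fibre: the kernel-checked form of «the exact remaining
gap» of row 2′MM0.  Standard axioms, Mathlib + cell prefix only.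
-/

namespace Summit.Ventures.PercRepro2
namespace MM0Pinned

open MM0Sector

variable {V : Type*} {E : Type*} [Fintype E] [DecidableEq E] [Fintype V] [DecidableEq V]

/-! ## The non-overlap triples cancel: the pattern coefficient is the overlap sum -/

section Overlap

variable (ends : E → Sym2 V) (s t u w v : V)

omit [Fintype E] [DecidableEq E] [Fintype V] [DecidableEq V] in
/-- Membership in `kplus`: `q ∈ K⁺_x` iff `q ∈ C_x(t)`, or `t ↔ w` and `q ∈ C_x(u)`, or `t ↔ u` and
`q ∈ C_x(w)`. -/
lemma mem_kplus {x : Config E} {q : V} :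
    q ∈ kplus ends t u w x ↔
      Conn ends x t q ∨ (Conn ends x t w ∧ Conn ends x u q) ∨ (Conn ends x t u ∧ Conn ends x w q) := by
  simp only [kplus, Set.mem_union, Set.mem_setOf_eq, mem_cluster, mem_connEvent, or_assoc]

omit [Fintype E] [DecidableEq E] [Fintype V] [DecidableEq V] in
/-- `x ∈ Zev` iff `v ∈ K⁺_x`. -/
lemma mem_Zev_iff_mem_kplus {x : Config E} :
    x ∈ Zev ends t u w v ↔ v ∈ kplus ends t u w x := by
  rw [mem_kplus]
  simp only [Zev, Set.mem_union, Set.mem_inter_iff, mem_connEvent]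
  constructor
  · rintro ((h | ⟨h1, h2⟩) | ⟨h1, h2⟩)
    · exact Or.inl h
    · exact Or.inr (Or.inl ⟨h2, conn_symm h1⟩)
    · exact Or.inr (Or.inr ⟨h2, conn_symm h1⟩)
  · rintro (h | ⟨h1, h2⟩ | ⟨h1, h2⟩)
    · exact Or.inl (Or.inl h)
    · exact Or.inl (Or.inr ⟨conn_symm h2, h1⟩)
    · exact Or.inr ⟨conn_symm h2, h1⟩

omit [Fintype E] [DecidableEq E] [Fintype V] [DecidableEq V] in
/-- `touches` is monotone. -/
lemma touches_mono {S T : Set V} (h : S ⊆ T) : touches ends S ⊆ touches ends T :=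
  fun _ ⟨a, ha, c, hac⟩ => ⟨a, h ha, c, hac⟩

omit [Fintype E] [DecidableEq E] [Fintype V] [DecidableEq V] in
/-- `C_x(t) ⊆ K⁺_x`. -/
lemma cluster_t_subset_kplus (x : Config E) : cluster ends x t ⊆ kplus ends t u w x :=
  fun _ hq => Or.inl (Or.inl hq)

omit [Fintype E] [DecidableEq E] [Fintype V] [DecidableEq V] in
/-- If `t ↔ w` then `C_x(u) ⊆ K⁺_x`. -/
lemma cluster_u_subset_kplus {x : Config E} (h : Conn ends x t w) :
    cluster ends x u ⊆ kplus ends t u w x :=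
  fun _ hq => Or.inl (Or.inr ⟨h, hq⟩)

omit [Fintype E] [DecidableEq E] [Fintype V] [DecidableEq V] in
/-- If `t ↔ u` then `C_x(w) ⊆ K⁺_x`. -/
lemma cluster_w_subset_kplus {x : Config E} (h : Conn ends x t u) :
    cluster ends x w ⊆ kplus ends t u w x :=
  fun _ hq => Or.inr ⟨h, hq⟩

/-- **The non-overlap predicate**: the s-clusters of `x` and `y` avoid `K⁺_x`, and `x`, `y` agree on
every edge touching both `K⁺_x` and `C_x(s) ∪ C_y(s)`. -/
def NonOverlap (xyz : Config E × Config E × Config E) : Prop :=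
  cluster ends xyz.2.1 s ∩ kplus ends t u w xyz.1 = ∅ ∧
    cluster ends xyz.1 s ∩ kplus ends t u w xyz.1 = ∅ ∧
    ∀ e ∈ touches ends (kplus ends t u w xyz.1),
      e ∈ touches ends (cluster ends xyz.1 s ∪ cluster ends xyz.2.1 s) → xyz.2.1 e = xyz.1 e

variable {ends s t u w v}

omit [Fintype E] [DecidableEq E] in
/-- Under non-overlap the exchanged `x`-copy agrees with `x` on every edge touching `K⁺_x`. -/
lemma sExchange_fst_eq_on_kplus {xyz : Config E × Config E × Config E}
    (h : NonOverlap ends s t u w xyz) {e : E} (he : e ∈ touches ends (kplus ends t u w xyz.1)) :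
    (sExchange ends s xyz).1 e = xyz.1 e := by
  show mix ends xyz.1 xyz.2.1 _ e = xyz.1 e
  by_cases hU : e ∈ touches ends (cluster ends xyz.1 s ∪ cluster ends xyz.2.1 s)
  · rw [mix_apply_of_mem hU]; exact h.2.2 e he hU
  · rw [mix_apply_of_notMem hU]

omit [Fintype E] [DecidableEq E] in
/-- `C_{x'}(t) = C_x(t)` under non-overlap. -/
lemma cluster_sExchange_t {xyz : Config E × Config E × Config E}
    (h : NonOverlap ends s t u w xyz) :
    cluster ends (sExchange ends s xyz).1 t = cluster ends xyz.1 t :=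
  cluster_eq_of_eqOn_touches (ω := xyz.1)
    (fun _ he => (sExchange_fst_eq_on_kplus h
      (touches_mono ends (cluster_t_subset_kplus ends t u w xyz.1) he)).symm) rfl

omit [Fintype E] [DecidableEq E] in
/-- `C_{x'}(u) = C_x(u)` under non-overlap when `t ↔ w`. -/
lemma cluster_sExchange_u {xyz : Config E × Config E × Config E}
    (h : NonOverlap ends s t u w xyz) (htw : Conn ends xyz.1 t w) :
    cluster ends (sExchange ends s xyz).1 u = cluster ends xyz.1 u :=
  cluster_eq_of_eqOn_touches (ω := xyz.1)
    (fun _ he => (sExchange_fst_eq_on_kplus h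
      (touches_mono ends (cluster_u_subset_kplus ends t u w htw) he)).symm) rfl

omit [Fintype E] [DecidableEq E] in
/-- `C_{x'}(w) = C_x(w)` under non-overlap when `t ↔ u`. -/
lemma cluster_sExchange_w {xyz : Config E × Config E × Config E}
    (h : NonOverlap ends s t u w xyz) (htu : Conn ends xyz.1 t u) :
    cluster ends (sExchange ends s xyz).1 w = cluster ends xyz.1 w :=
  cluster_eq_of_eqOn_touches (ω := xyz.1)
    (fun _ he => (sExchange_fst_eq_on_kplus h
      (touches_mono ends (cluster_w_subset_kplus ends t u w htu) he)).symm) rfl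

omit [Fintype E] [DecidableEq E] in
/-- `t ↔ q` in `x'` iff in `x`, under non-overlap. -/
lemma conn_sExchange_t_iff {xyz : Config E × Config E × Config E}
    (h : NonOverlap ends s t u w xyz) (q : V) :
    Conn ends (sExchange ends s xyz).1 t q ↔ Conn ends xyz.1 t q := by
  rw [← mem_cluster, ← mem_cluster, cluster_sExchange_t h]

omit [Fintype E] [DecidableEq E] in
/-- **`K⁺_{x'} = K⁺_x`** under non-overlap. -/
theorem kplus_sExchange {xyz : Config E × Config E × Config E}
    (h : NonOverlap ends s t u w xyz) :
    kplus ends t u w (sExchange ends s xyz).1 = kplus ends t u w xyz.1 := by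
  ext q
  rw [mem_kplus, mem_kplus, conn_sExchange_t_iff h, conn_sExchange_t_iff h, conn_sExchange_t_iff h]
  constructor
  · rintro (h1 | ⟨h1, h2⟩ | ⟨h1, h2⟩)
    · exact Or.inl h1
    · refine Or.inr (Or.inl ⟨h1, ?_⟩)
      rw [← mem_cluster, cluster_sExchange_u h h1] at h2; exact h2
    · refine Or.inr (Or.inr ⟨h1, ?_⟩)
      rw [← mem_cluster, cluster_sExchange_w h h1] at h2; exact h2
  · rintro (h1 | ⟨h1, h2⟩ | ⟨h1, h2⟩)
    · exact Or.inl h1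
    · refine Or.inr (Or.inl ⟨h1, ?_⟩)
      rw [← mem_cluster, cluster_sExchange_u h h1]; exact h2
    · refine Or.inr (Or.inr ⟨h1, ?_⟩)
      rw [← mem_cluster, cluster_sExchange_w h h1]; exact h2

omit [Fintype E] [DecidableEq E] in
/-- `x' ∈ Zev` iff `x ∈ Zev`, under non-overlap. -/
lemma zev_sExchange_iff {xyz : Config E × Config E × Config E}
    (h : NonOverlap ends s t u w xyz) :
    (sExchange ends s xyz).1 ∈ Zev ends t u w v ↔ xyz.1 ∈ Zev ends t u w v := by
  rw [mem_Zev_iff_mem_kplus, mem_Zev_iff_mem_kplus, kplus_sExchange h]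

omit [Fintype E] [DecidableEq E] [Fintype V] [DecidableEq V] in
/-- A configuration whose s-cluster avoids `K⁺` is not bridged. -/
lemma not_bridge_of_disjoint {x : Config E} (hd : cluster ends x s ∩ kplus ends t u w x = ∅) :
    x ∉ bridge ends s t u w := by
  rintro (⟨hsu, htw⟩ | ⟨hsw, htu⟩)
  · have hu : u ∈ cluster ends x s ∩ kplus ends t u w x :=
      ⟨hsu, cluster_u_subset_kplus ends t u w htw (mem_cluster_self ends x u)⟩
    rw [hd] at hu; exact hu
  · have hw : w ∈ cluster ends x s ∩ kplus ends t u w x :=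
      ⟨hsw, cluster_w_subset_kplus ends t u w htu (mem_cluster_self ends x w)⟩
    rw [hd] at hw; exact hw

omit [Fintype E] [DecidableEq E] [Fintype V] [DecidableEq V] in
/-- Under non-overlap, `x ∈ gate` iff `x ∈ R`. -/
lemma gate_iff_of_nonOverlap {xyz : Config E × Config E × Config E}
    (h : NonOverlap ends s t u w xyz) :
    xyz.1 ∈ gate ends s t u w ↔ xyz.1 ∈ (connEvent ends s t)ᶜ :=
  ⟨fun hg => hg.1, fun hR => ⟨hR, not_bridge_of_disjoint h.2.1⟩⟩

omit [Fintype E] [DecidableEq E] in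
/-- Under non-overlap, `x' ∈ gate` iff `y ∈ R`. -/
lemma gate_sExchange_iff_of_nonOverlap {xyz : Config E × Config E × Config E}
    (h : NonOverlap ends s t u w xyz) :
    (sExchange ends s xyz).1 ∈ gate ends s t u w ↔ xyz.2.1 ∈ (connEvent ends s t)ᶜ := by
  have hR : (sExchange ends s xyz).1 ∈ (connEvent ends s t)ᶜ ↔ xyz.2.1 ∈ (connEvent ends s t)ᶜ := by
    simp only [Set.mem_compl_iff, mem_connEvent, conn_sExchange_fst_iff]
  refine ⟨fun hg => hR.1 hg.1, fun hy => ⟨hR.2 hy, not_bridge_of_disjoint ?_⟩⟩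
  rw [cluster_sExchange_fst, kplus_sExchange h]; exact h.1

omit [Fintype E] [DecidableEq E] in
/-- Non-overlap is preserved by the s-exchange. -/
theorem nonOverlap_sExchange {xyz : Config E × Config E × Config E}
    (h : NonOverlap ends s t u w xyz) : NonOverlap ends s t u w (sExchange ends s xyz) := by
  refine ⟨?_, ?_, ?_⟩
  · rw [cluster_sExchange_snd, kplus_sExchange h]; exact h.2.1
  · rw [cluster_sExchange_fst, kplus_sExchange h]; exact h.1
  · intro e he hU
    rw [kplus_sExchange h] at he
    rw [cluster_sExchange_fst, cluster_sExchange_snd, Set.union_comm] at hU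
    have h1 : (sExchange ends s xyz).1 e = xyz.2.1 e := mix_apply_of_mem hU
    have h2 : (sExchange ends s xyz).2.1 e = xyz.1 e := mix_apply_of_mem hU
    rw [h1, h2, h.2.2 e he hU]

end Overlap

section OverlapKernel

variable {R : Type*} [CommRing R]
variable (ends : E → Sym2 V) (s t b u w v : V)

omit [Fintype E] [DecidableEq E] in
open Classical in
/-- Under non-overlap `g(x', z) = g(x, z)` whenever `x, y ∈ R`. -/
lemma tSide_sExchange_of_nonOverlap {xyz : Config E × Config E × Config E}
    (h : NonOverlap ends s t u w xyz) (hx : xyz.1 ∈ (connEvent ends s t)ᶜ)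
    (hy : xyz.2.1 ∈ (connEvent ends s t)ᶜ) :
    tSide (R := R) ends s t u w v (sExchange ends s xyz).1 xyz.2.2 =
      tSide (R := R) ends s t u w v xyz.1 xyz.2.2 := by
  unfold tSide
  rw [if_pos ((gate_sExchange_iff_of_nonOverlap h).2 hy), if_pos ((gate_iff_of_nonOverlap h).2 hx)]
  by_cases hz : xyz.1 ∈ Zev ends t u w v
  · rw [if_pos hz, if_pos ((zev_sExchange_iff (v := v) h).2 hz)]
  · rw [if_neg hz, if_neg (fun h' => hz ((zev_sExchange_iff (v := v) h).1 h'))]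

omit [Fintype E] [DecidableEq E] in
open Classical in
/-- **Non-overlap triples cancel along the s-exchange**: `K(χ) + K(σχ) = 0`. -/
theorem tripleKernel_add_sExchange_eq_zero {xyz : Config E × Config E × Config E}
    (h : NonOverlap ends s t u w xyz) :
    tripleKernel (R := R) ends s t b u w v xyz.1 xyz.2.1 xyz.2.2 +
      tripleKernel (R := R) ends s t b u w v (sExchange ends s xyz).1 (sExchange ends s xyz).2.1
        (sExchange ends s xyz).2.2 = 0 := by
  rw [tripleKernel_add_sExchange]
  by_cases hx : xyz.1 ∈ (connEvent ends s t)ᶜ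
  · by_cases hy : xyz.2.1 ∈ (connEvent ends s t)ᶜ
    · rw [tSide_sExchange_of_nonOverlap ends s t u w v h hx hy, sub_self, mul_zero]
    · rw [if_neg hy]; ring
  · rw [if_neg hx]; ring

variable [LinearOrder R] [IsStrictOrderedRing R]

omit [Fintype V] [DecidableEq V] in
/-- A σ-invariant set of triples on which `K + K ∘ σ = 0` carries kernel sum `0`. -/
theorem sum_filter_eq_zero_of_sExchange (pat : Config E × Config E × Config E)
    (P : Config E × Config E × Config E → Prop) [DecidablePred P]
    (hP : ∀ xyz, P xyz → P (sExchange ends s xyz))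
    (hK : ∀ xyz, P xyz →
      tripleKernel (R := R) ends s t b u w v xyz.1 xyz.2.1 xyz.2.2 +
        tripleKernel (R := R) ends s t b u w v (sExchange ends s xyz).1 (sExchange ends s xyz).2.1
          (sExchange ends s xyz).2.2 = 0) :
    ∑ xyz ∈ (fibre pat).filter P,
      tripleKernel (R := R) ends s t b u w v xyz.1 xyz.2.1 xyz.2.2 = 0 := by
  set S := (fibre pat).filter P with hSdef
  have hmem : ∀ a ∈ S, sExchange ends s a ∈ S := by
    intro a ha
    rw [hSdef, Finset.mem_filter] at ha ⊢
    exact ⟨sExchange_mem_fibre ends s ha.1, hP a ha.2⟩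
  have hre : ∑ xyz ∈ S, tripleKernel (R := R) ends s t b u w v xyz.1 xyz.2.1 xyz.2.2 =
      ∑ xyz ∈ S, tripleKernel (R := R) ends s t b u w v (sExchange ends s xyz).1
        (sExchange ends s xyz).2.1 (sExchange ends s xyz).2.2 := by
    refine Finset.sum_nbij' (sExchange ends s) (sExchange ends s) hmem hmem
      (fun a _ => sExchange_sExchange a) (fun a _ => sExchange_sExchange a) (fun a _ => ?_)
    rw [sExchange_sExchange]
  have hsum0 : ∑ xyz ∈ S, tripleKernel (R := R) ends s t b u w v xyz.1 xyz.2.1 xyz.2.2 +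
      ∑ xyz ∈ S, tripleKernel (R := R) ends s t b u w v (sExchange ends s xyz).1
        (sExchange ends s xyz).2.1 (sExchange ends s xyz).2.2 = 0 := by
    rw [← Finset.sum_add_distrib]
    exact Finset.sum_eq_zero fun xyz hxyz => hK xyz (Finset.mem_filter.1 hxyz).2
  rw [hre] at hsum0
  have hself : ∑ xyz ∈ S, tripleKernel (R := R) ends s t b u w v (sExchange ends s xyz).1
      (sExchange ends s xyz).2.1 (sExchange ends s xyz).2.2 = 0 := by
    rcases lt_trichotomy (∑ xyz ∈ S, tripleKernel (R := R) ends s t b u w v (sExchange ends s xyz).1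
        (sExchange ends s xyz).2.1 (sExchange ends s xyz).2.2) 0 with h | h | h
    · exact absurd hsum0 (ne_of_lt (add_neg h h))
    · exact h
    · exact absurd hsum0 (ne_of_gt (add_pos h h))
  rw [hre]; exact hself

open Classical in
/-- The sum of the kernel over the non-overlap part of a fibre vanishes. -/
theorem sum_nonOverlap_eq_zero (pat : Config E × Config E × Config E) :
    ∑ xyz ∈ (fibre pat).filter (NonOverlap ends s t u w),
      tripleKernel (R := R) ends s t b u w v xyz.1 xyz.2.1 xyz.2.2 = 0 :=
  sum_filter_eq_zero_of_sExchange (R := R) ends s t b u w v pat (NonOverlap ends s t u w)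
    (fun _ h => nonOverlap_sExchange h)
    (fun _ h => tripleKernel_add_sExchange_eq_zero ends s t b u w v h)

omit [Fintype V] [DecidableEq V] in
open Classical in
/-- The triples on which the s-exchange does NOT change the t-side functional `g` carry kernel
sum `0` (the sharpest cancellation: `K + K ∘ σ` vanishes there by `tripleKernel_add_sExchange`). -/
theorem sum_tSide_eq_eq_zero (pat : Config E × Config E × Config E) :
    ∑ xyz ∈ (fibre pat).filter (fun xyz =>
        tSide (R := R) ends s t u w v (sExchange ends s xyz).1 xyz.2.2 =
          tSide (R := R) ends s t u w v xyz.1 xyz.2.2),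
      tripleKernel (R := R) ends s t b u w v xyz.1 xyz.2.1 xyz.2.2 = 0 := by
  refine sum_filter_eq_zero_of_sExchange (R := R) ends s t b u w v pat (fun xyz =>
      tSide (R := R) ends s t u w v (sExchange ends s xyz).1 xyz.2.2 =
        tSide (R := R) ends s t u w v xyz.1 xyz.2.2) (fun xyz h => ?_) (fun xyz h => ?_)
  · show tSide (R := R) ends s t u w v (sExchange ends s (sExchange ends s xyz)).1
        (sExchange ends s xyz).2.2 = tSide (R := R) ends s t u w v (sExchange ends s xyz).1
        (sExchange ends s xyz).2.2
    rw [sExchange_sExchange, sExchange_third]; exact h.symm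
  · rw [tripleKernel_add_sExchange, h, sub_self, mul_zero]

open Classical in
/-- **The pattern coefficient is the overlap sum**: `c(pat) = ∑_{xyz ∈ fibre(pat), ¬NonOverlap} K(xyz)` —
the triples whose s-clusters avoid `K⁺_x` (and whose `x`, `y` agree on the edges touching both) cancel
along the s-exchange, so all of `PinnedMM0` sits in the OVERLAPPING triples. -/
theorem patternCoeff3_eq_sum_overlap (pat : Config E × Config E × Config E) :
    patternCoeff3 (R := R) ends s t b u w v pat =
      ∑ xyz ∈ (fibre pat).filter (fun xyz => ¬ NonOverlap ends s t u w xyz),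
        tripleKernel (R := R) ends s t b u w v xyz.1 xyz.2.1 xyz.2.2 := by
  have hsum : patternCoeff3 (R := R) ends s t b u w v pat =
      ∑ xyz ∈ fibre pat, tripleKernel (R := R) ends s t b u w v xyz.1 xyz.2.1 xyz.2.2 := by
    unfold patternCoeff3 fibre
    rw [Finset.sum_filter]
    rfl
  rw [hsum, ← Finset.sum_filter_add_sum_filter_not (fibre pat) (NonOverlap ends s t u w),
    sum_nonOverlap_eq_zero, zero_add]

omit [Fintype V] [DecidableEq V] in
open Classical in
/-- **The sharpest form**: the pattern coefficient is the sum over the triples on which the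
s-exchange CHANGES the t-side functional `g` of the `x`-copy. -/
theorem patternCoeff3_eq_sum_tSide_ne (pat : Config E × Config E × Config E) :
    patternCoeff3 (R := R) ends s t b u w v pat =
      ∑ xyz ∈ (fibre pat).filter (fun xyz =>
          ¬ (tSide (R := R) ends s t u w v (sExchange ends s xyz).1 xyz.2.2 =
            tSide (R := R) ends s t u w v xyz.1 xyz.2.2)),
        tripleKernel (R := R) ends s t b u w v xyz.1 xyz.2.1 xyz.2.2 := by
  have hsum : patternCoeff3 (R := R) ends s t b u w v pat =
      ∑ xyz ∈ fibre pat, tripleKernel (R := R) ends s t b u w v xyz.1 xyz.2.1 xyz.2.2 := by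
    unfold patternCoeff3 fibre
    rw [Finset.sum_filter]
    rfl
  rw [hsum, ← Finset.sum_filter_add_sum_filter_not (fibre pat) (fun xyz =>
      tSide (R := R) ends s t u w v (sExchange ends s xyz).1 xyz.2.2 =
        tSide (R := R) ends s t u w v xyz.1 xyz.2.2),
    sum_tSide_eq_eq_zero, zero_add]

end OverlapKernel

end MM0Pinned
end Summit.Ventures.PercRepro2
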